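import Mathlib
import Summits.MatrixMultiplication.MatrixMultiplication.Theses.FourierTwoFamiliesModP

/-!
# The kill ladder down to `PrimeDensityDecay` (route `FourierTwoFamiliesModP`, item stmt-MatrixMultiplication-14311)

Support item `PrimeDensityDecay` (qualitative Roth-type decay `n·s ≤ ε·p` for balanced SDPP families in
`ℤ/pℤ`, `s ≥ s₀(ε)`) sits at the bottom of the route's kill ladder.  This file lands the ladder's last
rungs and the item's trivial normalisations as kernel-checked glue, so that the item closes by one line
as soon as either sibling closes, and so that a combinatorial proof may target the cleanest form:

* `primeDensityDecay_of_primeCyclicPowerGain : PrimeCyclicPowerGain → PrimeDensityDecay`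
  (`n·s^{1+c} ≤ p` gives `n·s ≤ p/s^c ≤ ε p` once `s ≥ (1/ε)^{1/c}`);
* `primeDensityDecay_of_primeLogDecay : PrimeLogDecay → PrimeDensityDecay`
  (`n·s·(log s)^c ≤ p` gives `n·s ≤ ε p` once `log s ≥ (1/ε)^{1/c}`, i.e. `s ≥ exp((1/ε)^{1/c})`);
* `density_le_of_gt_half` : the range `ε > 1/2` of the item follows from the route's support decl
  `HalfDensity` (item stmt-14316, PROVED in tree as `Theorems.halfDensity_proof`; taken here as a
  hypothesis by name so that this file does not depend on that module): `2·n·s² ≤ p·(s+1)` gives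
  `n·s ≤ ε·p` once `s ≥ ⌈1/(2ε−1)⌉ + 1`;
* `primeDensityDecay_iff_le_half` : hence, given `HalfDensity`, the item is equivalent to its restriction
  to `0 < ε ≤ 1/2`;
* `primeDensityDecay_iff_nat` : and to the integral form "for every `m : ℕ` there is `s₀(m)` beyond which
  `n·s·(m+1) ≤ p`" (the shape a counting proof produces).

No new definitions; hypotheses (W), (X) are inlined verbatim as in the route file.  Nothing here bears on
the open regime `0 < ε ≤ 1/2`, `n ≫ s` of the item itself.
-/

-- the doubled path component `MatrixMultiplication.MatrixMultiplication` is the tree's layout (summit = problem)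
set_option linter.dupNamespace false

namespace Summit.MatrixMultiplication.MatrixMultiplication.Theorems.PrimeDensityDecay.Ladder

open Summit.MatrixMultiplication.MatrixMultiplication.Theses.FourierTwoFamiliesModP

/-- **Rung 1.** A fixed power saving implies qualitative decay:
`PrimeCyclicPowerGain → PrimeDensityDecay`.  Given `c > 0` with `n·s^{1+c} ≤ p` for `s ≥ s₀`, and
`ε > 0`, every `s ≥ max s₀ (⌈(1/ε)^{1/c}⌉ + 1)` has `s^c ≥ 1/ε`, whence `n·s ≤ p/s^c ≤ ε·p`. -/
theorem primeDensityDecay_of_primeCyclicPowerGain (h : PrimeCyclicPowerGain) : PrimeDensityDecay := by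
  obtain ⟨c, hc, s₀, hs₀⟩ := h
  intro ε hε
  refine ⟨max s₀ (⌈(1 / ε) ^ (1 / c)⌉₊ + 1), ?_⟩
  intro p hp n s A B hs hcard hW hX
  have hs0 : s₀ ≤ s := le_trans (le_max_left _ _) hs
  have hs1 : ⌈(1 / ε) ^ (1 / c)⌉₊ + 1 ≤ s := le_trans (le_max_right _ _) hs
  have hmain := hs₀ p hp n s A B hs0 hcard hW hX
  have hspos : (0 : ℝ) < (s : ℝ) := by
    have : (1 : ℕ) ≤ s := le_trans (Nat.le_add_left 1 _) hs1
    exact_mod_cast this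
  have hsc_pos : (0 : ℝ) < (s : ℝ) ^ c := Real.rpow_pos_of_pos hspos c
  -- `s ^ c ≥ 1/ε`
  have hL_nonneg : (0 : ℝ) ≤ (1 / ε) ^ (1 / c) := Real.rpow_nonneg (by positivity) _
  have hsL : (1 / ε) ^ (1 / c) ≤ (s : ℝ) := by
    have h1 : (1 / ε) ^ (1 / c) ≤ (⌈(1 / ε) ^ (1 / c)⌉₊ : ℝ) := Nat.le_ceil _
    have h2 : ((⌈(1 / ε) ^ (1 / c)⌉₊ : ℕ) : ℝ) ≤ (s : ℝ) := by
      exact_mod_cast le_trans (Nat.le_succ _) hs1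
    exact le_trans h1 h2
  have hsc : 1 / ε ≤ (s : ℝ) ^ c := by
    have h1 : ((1 / ε) ^ (1 / c)) ^ c ≤ (s : ℝ) ^ c := Real.rpow_le_rpow hL_nonneg hsL hc.le
    have h2 : ((1 / ε) ^ (1 / c)) ^ c = 1 / ε := by
      rw [← Real.rpow_mul (by positivity), one_div_mul_cancel hc.ne', Real.rpow_one]
    rw [h2] at h1
    exact h1
  -- `n·s·s^c ≤ p`
  have hsplit : (s : ℝ) ^ (1 + c) = (s : ℝ) * (s : ℝ) ^ c := by
    rw [Real.rpow_add hspos, Real.rpow_one]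
  rw [hsplit, ← mul_assoc] at hmain
  have hns : (n : ℝ) * (s : ℝ) ≤ (p : ℝ) / (s : ℝ) ^ c := by
    rw [le_div_iff₀ hsc_pos]; exact hmain
  have hdiv : (p : ℝ) / (s : ℝ) ^ c ≤ (p : ℝ) / (1 / ε) :=
    div_le_div_of_nonneg_left (by positivity) (by positivity) hsc
  calc (n : ℝ) * (s : ℝ) ≤ (p : ℝ) / (s : ℝ) ^ c := hns
    _ ≤ (p : ℝ) / (1 / ε) := hdiv
    _ = ε * (p : ℝ) := by rw [div_div_eq_mul_div, div_one, mul_comm]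

/-- **Rung 2.** A log-power saving implies qualitative decay: `PrimeLogDecay → PrimeDensityDecay`.
Given `c > 0` with `n·s·(log s)^c ≤ p` for `s ≥ s₀`, and `ε > 0`, every
`s ≥ max s₀ (⌈exp((1/ε)^{1/c})⌉ + 1)` has `(log s)^c ≥ 1/ε`, whence `n·s ≤ p/(log s)^c ≤ ε·p`. -/
theorem primeDensityDecay_of_primeLogDecay (h : PrimeLogDecay) : PrimeDensityDecay := by
  obtain ⟨c, hc, s₀, hs₀⟩ := h
  intro ε hε
  refine ⟨max s₀ (⌈Real.exp ((1 / ε) ^ (1 / c))⌉₊ + 1), ?_⟩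
  intro p hp n s A B hs hcard hW hX
  have hs0 : s₀ ≤ s := le_trans (le_max_left _ _) hs
  have hs1 : ⌈Real.exp ((1 / ε) ^ (1 / c))⌉₊ + 1 ≤ s := le_trans (le_max_right _ _) hs
  have hmain := hs₀ p hp n s A B hs0 hcard hW hX
  set L : ℝ := (1 / ε) ^ (1 / c) with hLdef
  have hL_pos : 0 < L := Real.rpow_pos_of_pos (by positivity) _
  have hspos : (0 : ℝ) < (s : ℝ) := by
    have : (1 : ℕ) ≤ s := le_trans (Nat.le_add_left 1 _) hs1
    exact_mod_cast this
  -- `log s ≥ L`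
  have hexp_le : Real.exp L ≤ (s : ℝ) := by
    have h1 : Real.exp L ≤ (⌈Real.exp L⌉₊ : ℝ) := Nat.le_ceil _
    have h2 : ((⌈Real.exp L⌉₊ : ℕ) : ℝ) ≤ (s : ℝ) := by
      exact_mod_cast le_trans (Nat.le_succ _) hs1
    exact le_trans h1 h2
  have hlog : L ≤ Real.log (s : ℝ) := (Real.le_log_iff_exp_le hspos).2 hexp_le
  have hlog_pos : 0 < Real.log (s : ℝ) := lt_of_lt_of_le hL_pos hlog
  have hlc_pos : 0 < Real.log (s : ℝ) ^ c := Real.rpow_pos_of_pos hlog_pos c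
  have hlc : 1 / ε ≤ Real.log (s : ℝ) ^ c := by
    have h1 : L ^ c ≤ Real.log (s : ℝ) ^ c := Real.rpow_le_rpow hL_pos.le hlog hc.le
    have h2 : L ^ c = 1 / ε := by
      rw [hLdef, ← Real.rpow_mul (by positivity), one_div_mul_cancel hc.ne', Real.rpow_one]
    rw [h2] at h1
    exact h1
  have hns : (n : ℝ) * (s : ℝ) ≤ (p : ℝ) / Real.log (s : ℝ) ^ c := by
    rw [le_div_iff₀ hlc_pos]; exact hmain
  have hdiv : (p : ℝ) / Real.log (s : ℝ) ^ c ≤ (p : ℝ) / (1 / ε) :=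
    div_le_div_of_nonneg_left (by positivity) (by positivity) hlc
  calc (n : ℝ) * (s : ℝ) ≤ (p : ℝ) / Real.log (s : ℝ) ^ c := hns
    _ ≤ (p : ℝ) / (1 / ε) := hdiv
    _ = ε * (p : ℝ) := by rw [div_div_eq_mul_div, div_one, mul_comm]

/-- **The range `ε > 1/2` follows from `HalfDensity`.**  Assuming the route's half-density support
decl (`2·n·s² ≤ |H|·(s+1)` for balanced SDPP families in any finite abelian group; proved in tree as
`Theorems.halfDensity_proof`), for every `ε > 1/2` there is `s₀` (namely `⌈1/(2ε−1)⌉ + 1`) such that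
every balanced SDPP family of `s`-sets, `s ≥ s₀`, in `ℤ/pℤ` (`p` prime) has `n·s ≤ ε·p`:
`n·s ≤ p·(1/2 + 1/(2s)) ≤ ε·p` once `s ≥ 1/(2ε−1)`.  (Primality is used only to have
`Fintype (ZMod p)` with `card = p`.) -/
theorem density_le_of_gt_half (hH : HalfDensity) (ε : ℝ) (hε : 1 / 2 < ε) :
    ∃ s₀ : ℕ, ∀ p : ℕ, p.Prime → ∀ (n s : ℕ) (A B : Fin n → Finset (ZMod p)), s₀ ≤ s →
      (∀ i : Fin n, (A i).card = s ∧ (B i).card = s) →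
      (∀ i : Fin n, ∀ a ∈ A i, ∀ a' ∈ A i, ∀ b ∈ B i, ∀ b' ∈ B i,
        (a - a') + (b - b') = 0 → a = a' ∧ b = b') →
      (∀ i j k : Fin n, ∀ a ∈ A i, ∀ a' ∈ A j, ∀ b ∈ B j, ∀ b' ∈ B k,
        (a - a') + (b - b') = 0 → i = k) →
      (n : ℝ) * (s : ℝ) ≤ ε * (p : ℝ) := by
  have h2e : 0 < 2 * ε - 1 := by linarith
  refine ⟨⌈1 / (2 * ε - 1)⌉₊ + 1, ?_⟩
  intro p hp n s A B hs hcard hW hX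
  haveI : Fact p.Prime := ⟨hp⟩
  have hs1 : 1 ≤ s := le_trans (Nat.le_add_left 1 _) hs
  have hnat := hH (ZMod p) n s A B hs1 hcard hW hX
  rw [ZMod.card p] at hnat
  have hhalf : 2 * (s : ℝ) ^ 2 * (n : ℝ) ≤ (p : ℝ) * ((s : ℝ) + 1) := by
    have h1 : ((2 * n * s ^ 2 : ℕ) : ℝ) ≤ ((p * (s + 1) : ℕ) : ℝ) := by exact_mod_cast hnat
    have h2 : ((2 * n * s ^ 2 : ℕ) : ℝ) = 2 * (s : ℝ) ^ 2 * (n : ℝ) := by push_cast; ring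
    have h3 : ((p * (s + 1) : ℕ) : ℝ) = (p : ℝ) * ((s : ℝ) + 1) := by push_cast; ring
    rw [h2, h3] at h1
    exact h1
  have hspos : (0 : ℝ) < (s : ℝ) := by exact_mod_cast hs1
  have hsge : 1 / (2 * ε - 1) ≤ (s : ℝ) := by
    have h1 : 1 / (2 * ε - 1) ≤ (⌈1 / (2 * ε - 1)⌉₊ : ℝ) := Nat.le_ceil _
    have h2 : ((⌈1 / (2 * ε - 1)⌉₊ : ℕ) : ℝ) ≤ (s : ℝ) := by
      exact_mod_cast le_trans (Nat.le_succ _) hs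
    exact le_trans h1 h2
  have hkey : (s : ℝ) + 1 ≤ 2 * ε * (s : ℝ) := by
    have h1 : 1 ≤ (s : ℝ) * (2 * ε - 1) := by
      rwa [div_le_iff₀ h2e] at hsge
    nlinarith [h1]
  have hp0 : (0 : ℝ) ≤ (p : ℝ) := by positivity
  have h1 : 2 * (s : ℝ) ^ 2 * (n : ℝ) ≤ 2 * ε * (p : ℝ) * (s : ℝ) := by
    calc 2 * (s : ℝ) ^ 2 * (n : ℝ) ≤ (p : ℝ) * ((s : ℝ) + 1) := hhalf
      _ ≤ (p : ℝ) * (2 * ε * (s : ℝ)) := mul_le_mul_of_nonneg_left hkey hp0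
      _ = 2 * ε * (p : ℝ) * (s : ℝ) := by ring
  have h2 : (s : ℝ) * ((n : ℝ) * (s : ℝ)) ≤ (s : ℝ) * (ε * (p : ℝ)) := by nlinarith [h1]
  exact le_of_mul_le_mul_left h2 hspos

/-- Hence, given `HalfDensity` (proved in tree), `PrimeDensityDecay` is equivalent to its restriction
to `0 < ε ≤ 1/2` — the only open range. -/
theorem primeDensityDecay_iff_le_half (hH : HalfDensity) :
    PrimeDensityDecay ↔
      ∀ ε : ℝ, 0 < ε → ε ≤ 1 / 2 → ∃ s₀ : ℕ, ∀ p : ℕ, p.Prime →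
        ∀ (n s : ℕ) (A B : Fin n → Finset (ZMod p)), s₀ ≤ s →
        (∀ i : Fin n, (A i).card = s ∧ (B i).card = s) →
        (∀ i : Fin n, ∀ a ∈ A i, ∀ a' ∈ A i, ∀ b ∈ B i, ∀ b' ∈ B i,
          (a - a') + (b - b') = 0 → a = a' ∧ b = b') →
        (∀ i j k : Fin n, ∀ a ∈ A i, ∀ a' ∈ A j, ∀ b ∈ B j, ∀ b' ∈ B k,
          (a - a') + (b - b') = 0 → i = k) →
        (n : ℝ) * (s : ℝ) ≤ ε * (p : ℝ) := by
  constructor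
  · intro h ε hε _
    exact h ε hε
  · intro h ε hε
    by_cases hle : ε ≤ 1 / 2
    · exact h ε hε hle
    · exact density_le_of_gt_half hH ε (lt_of_not_ge hle)

/-- **Integral form.**  `PrimeDensityDecay` is equivalent to: for every `m : ℕ` there is `s₀` beyond which
every balanced SDPP family in `ℤ/pℤ` satisfies `n·s·(m+1) ≤ p` (take `ε = 1/(m+1)`, resp. `m` with
`1/(m+1) < ε`). -/
theorem primeDensityDecay_iff_nat :
    PrimeDensityDecay ↔
      ∀ m : ℕ, ∃ s₀ : ℕ, ∀ p : ℕ, p.Prime →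
        ∀ (n s : ℕ) (A B : Fin n → Finset (ZMod p)), s₀ ≤ s →
        (∀ i : Fin n, (A i).card = s ∧ (B i).card = s) →
        (∀ i : Fin n, ∀ a ∈ A i, ∀ a' ∈ A i, ∀ b ∈ B i, ∀ b' ∈ B i,
          (a - a') + (b - b') = 0 → a = a' ∧ b = b') →
        (∀ i j k : Fin n, ∀ a ∈ A i, ∀ a' ∈ A j, ∀ b ∈ B j, ∀ b' ∈ B k,
          (a - a') + (b - b') = 0 → i = k) →
        n * s * (m + 1) ≤ p := by
  constructor
  · intro h m
    have hm1 : (0 : ℝ) < 1 / ((m : ℝ) + 1) := by positivity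
    obtain ⟨s₀, hs₀⟩ := h (1 / ((m : ℝ) + 1)) hm1
    refine ⟨s₀, fun p hp n s A B hs hcard hW hX => ?_⟩
    have key := hs₀ p hp n s A B hs hcard hW hX
    have hm0 : (0 : ℝ) < (m : ℝ) + 1 := by positivity
    have key' : (n : ℝ) * (s : ℝ) * ((m : ℝ) + 1) ≤ (p : ℝ) := by
      have := mul_le_mul_of_nonneg_right key hm0.le
      calc (n : ℝ) * (s : ℝ) * ((m : ℝ) + 1) ≤ 1 / ((m : ℝ) + 1) * (p : ℝ) * ((m : ℝ) + 1) := this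
        _ = (p : ℝ) := by field_simp
    exact_mod_cast key'
  · intro h ε hε
    obtain ⟨m, hm⟩ := exists_nat_one_div_lt hε
    obtain ⟨s₀, hs₀⟩ := h m
    refine ⟨s₀, fun p hp n s A B hs hcard hW hX => ?_⟩
    have key := hs₀ p hp n s A B hs hcard hW hX
    have key' : (n : ℝ) * (s : ℝ) * ((m : ℝ) + 1) ≤ (p : ℝ) := by exact_mod_cast key
    have hm0 : (0 : ℝ) < (m : ℝ) + 1 := by positivity
    have h1 : (n : ℝ) * (s : ℝ) ≤ (p : ℝ) / ((m : ℝ) + 1) := by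
      rw [le_div_iff₀ hm0]; exact key'
    have hp0 : (0 : ℝ) ≤ (p : ℝ) := by positivity
    calc (n : ℝ) * (s : ℝ) ≤ (p : ℝ) / ((m : ℝ) + 1) := h1
      _ = 1 / ((m : ℝ) + 1) * (p : ℝ) := by ring
      _ ≤ ε * (p : ℝ) := mul_le_mul_of_nonneg_right hm.le hp0

/-! ## Registered stub forms (the item's `supports` bookkeeping requires a registered name + signature) -/

/-- Registered stub `stub_ladderFromPowerGain` = Rung 1 with fully qualified names. -/
theorem stub_ladderFromPowerGain : Summit.MatrixMultiplication.MatrixMultiplication.Theses.FourierTwoFamiliesModP.PrimeCyclicPowerGain → Summit.MatrixMultiplication.MatrixMultiplication.Theses.FourierTwoFamiliesModP.PrimeDensityDecay :=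
  primeDensityDecay_of_primeCyclicPowerGain

/-- Registered stub `stub_ladderFromLogDecay` = Rung 2 with fully qualified names. -/
theorem stub_ladderFromLogDecay : Summit.MatrixMultiplication.MatrixMultiplication.Theses.FourierTwoFamiliesModP.PrimeLogDecay → Summit.MatrixMultiplication.MatrixMultiplication.Theses.FourierTwoFamiliesModP.PrimeDensityDecay :=
  primeDensityDecay_of_primeLogDecay

/-- Registered stub `stub_ladderHalfRange` = the `ε > 1/2` range from `HalfDensity`, fully qualified. -/
theorem stub_ladderHalfRange : Summit.MatrixMultiplication.MatrixMultiplication.Theses.FourierTwoFamiliesModP.HalfDensity → ∀ ε : ℝ, 1 / 2 < ε → ∃ s₀ : ℕ, ∀ p : ℕ, p.Prime → ∀ (n s : ℕ) (A B : Fin n → Finset (ZMod p)), s₀ ≤ s → (∀ i : Fin n, (A i).card = s ∧ (B i).card = s) → (∀ i : Fin n, ∀ a ∈ A i, ∀ a' ∈ A i, ∀ b ∈ B i, ∀ b' ∈ B i, (a - a') + (b - b') = 0 → a = a' ∧ b = b') → (∀ i j k : Fin n, ∀ a ∈ A i, ∀ a' ∈ A j, ∀ b ∈ B j, ∀ b'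 ∈ B k, (a - a') + (b - b') = 0 → i = k) → (n : ℝ) * (s : ℝ) ≤ ε * (p : ℝ) :=
  density_le_of_gt_half

end Summit.MatrixMultiplication.MatrixMultiplication.Theorems.PrimeDensityDecay.Ladder
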